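import Summits.HodgeConjecture.CorCM.GaloisLeftStabiliserInducedType
import Summits.HodgeConjecture.CorCM.GaloisDicyclicQuotientField
import Summits.HodgeConjecture.CorCM.GaloisDicyclicDegenerateTypes
import Summits.HodgeConjecture.CorCM.GaloisDicyclicBinders
import Literature.AlgebraicGeometry.ComplexMultiplication.EndomorphismFieldNondegenerateType
import Literature.NumberTheory.ComplexMultiplication.ShimuraTaniyamaHecke
import HarnessLib

/-!
# Galois CM fields with dicyclic Galois group `Dic_n`, `n = 2^k q`: EVERY abelian variety with complex multiplication
# by the field is STABLY NONDEGENERATE — the Hodge conjecture for all of them and all their powers, no simplicity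

COR-CM (cell `pub-hodgecm2`), binder seat b04 (gen 21), count-neutral claim DICYCLIC-ALLTYPES, part III — THE THEOREM
of the ALL-TYPES programme (`A7-JUNCTION.md`, gen 20 plan P2–P3).  KERNEL ONLY: theorems; no definition, no named
fact, no `sorry`.  `HC_CM` is neither used nor claimed: this is the Hodge conjecture for a NAMED CLASS of abelian
varieties, UNCONDITIONALLY.

Gen 20 (parts IV–VI, `GaloisDicyclicNondegenerate`, `…DegenerateTypes`, `…Binders`): for a Galois CM field `F` with
`Gal(F/ℚ) ≅ Dic_n` (Mathlib `QuaternionGroup n`), `n = 2^k q` with `q` an odd prime, every PRIMITIVE CM type is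
nondegenerate, so every SIMPLE abelian variety `X` of dimension `2n` with `F ↪ End⁰(X)` satisfies the Hodge
conjecture with all its powers.  Here the simplicity hypothesis is REMOVED.  THE type `Φ = cmTypeOfPair φ hF` of a pair
`(X, φ : F →+* End⁰(X))`, `[F:ℚ] = 4n = 2 dim X` (Shimura §5.2), is either primitive — then nondegenerate (part IV)
and `X ∼ A_Φ` is stably nondegenerate (`EndFieldFullDegree.isStablyNondegenerate_of_isNondegenerate_cmTypeOfPair`) —
or imprimitive: then its set on the model is `a^{2^{k+1}}`-stable (part XIII), so `Φ` is INDUCED from the fixed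
field `K₀ = F^{C_q}` (part I `exists_inducedCMType_fixedField_of_leftStabiliser`), a Galois CM field with group
`Q_{2^{k+2}} = Dic_{2^k}` (part II `exists_kernel_subgroup_quaternion`) ALL of whose CM types are nondegenerate (part
IV `isNondegenerate_quaternion`; `k = 0`: `Dic_1 ≅ ℤ/4`); and Shimura's `X ∼ B^q` for the variety of record `B` of
`(K₀; Φ₀)` makes `X` stably nondegenerate (lit-hodgefound's junction
`EndFieldFullDegree.isStablyNondegenerate_of_isNondegenerate`, Shimura §5.1 Prop. 3 / §6.2 Thm. 3, Gordon Thm. 6.4).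

* §1 **`isNondegenerate_or_exists_induced_dicyclic`** — every CM type of `F` is nondegenerate or induced from a
  NONDEGENERATE CM type of the CM subfield `K₀` of degree `2^{k+2}` (type level, no geometry).
* §2 **`isStablyNondegenerate_of_ringHom_dicyclic`** — `Gal(F/ℚ) ≅ Dic_n`, `n = 2^k q`: EVERY complex abelian
  variety `X` of dimension `2n` with `φ : F →+* End⁰(X)` has `B = D` on all powers; the Hodge conjecture for every
  power and for everything isogenous to a power (`hodgeConjectureFor_powSucc_of_ringHom_dicyclic`,
  `hodgeConjectureFor_of_isIsogenous_powSucc_dicyclic`); the realisation forms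
  `isStablyNondegenerate_of_isCMTypeRealisation_dicyclic`, **`hodgeConjectureFor_pow_dicyclic`** (gen 20's
  `hodgeConjectureFor_pow_of_isSimple_dicyclic` WITHOUT `A.IsSimple`); the `n = 2^k` companions
  (`isStablyNondegenerate_of_ringHom_quaternion`) and the uniform form for `n = 2^k m`, `m ∈ {1} ∪ odd primes`.
* §3 **THE CLASSIFICATION `forall_isStablyNondegenerate_iff_dicyclic`** — `n = 2^k m`, `m` odd: every abelian variety
  of dimension `2n` with an `F`-action is stably nondegenerate ⟺ `m = 1 ∨ m` prime (⇒ by part V's simple degenerate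
  varieties and Hazama's criterion).
* §4 `HCOnClass` display `hcOnClass_isIsogenous_powSucc_galoisCM_dicyclic` (no simplicity).

## References

* [Shimura1998] G. Shimura, *Abelian Varieties with Complex Multiplication and Modular Functions* (1998), §5.1
  Prop. 3, §5.2, §6.2 Thm. 3, §8.2 Prop. 26.
* [Gordon1999HodgeAVSurvey] B. B. Gordon, *A survey of the Hodge conjecture for abelian varieties*, Thm. 6.4,
  Def. 7.6, Rem. 7.6.1, §9.3–9.4.
* [Kubota1965] T. Kubota, Trans. AMS 118 (1965), §2, §4 Lemma 2.
* [vanGeemen1994HodgeAV] B. van Geemen, *An introduction to the Hodge conjecture for abelian varieties*, Lemma 3.7.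
-/

noncomputable section

open CategoryTheory CategoryTheory.Limits NumberField

namespace Summit.HodgeConjecture.CorCM.GaloisDicyclic

open Literature.NumberTheory.ComplexMultiplication
open Literature.AlgebraicGeometry Literature.AlgebraicGeometry.Motives Literature.AlgebraicGeometry.HodgeTheory
open Literature.AlgebraicGeometry.Motives.AbelianVariety
open Literature.AlgebraicGeometry.ComplexMultiplication
open Literature.AlgebraicGeometry.Pohlmann1968
open Summit.HodgeConjecture.CorCM.GaloisRank
open Summit.HodgeConjecture.HodgeConjecture.Ring2.ClassTargets
open QuaternionGroup

variable {F : Type} [Field F] [NumberField F] [IsCMField F] [IsGalois ℚ F]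
variable {n : ℕ} [NeZero n]

/-! ## §1 Every CM type is nondegenerate or induced from a nondegenerate type of `K₀ = F^{C_q}` -/

omit [IsGalois ℚ F] in
/-- An odd prime is not `2`. [folklore] -/
private theorem ne_two_of_odd {m : ℕ} (hm : Odd m) : m ≠ 2 := by
  obtain ⟨j, rfl⟩ := hm
  omega

/-- **THE TYPE-LEVEL DICHOTOMY.**  `Gal(F/ℚ) ≅ Dic_n`, `n = 2^k q` (`q` an odd prime): every CM type `Φ` of `F` is
either NONDEGENERATE (when primitive, part IV), or INDUCED — `Φ = inducedCMType (algebraMap K₀ F) Φ₀` — from a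
NONDEGENERATE CM type `Φ₀` of a CM subfield `K₀ ≤ F`, Galois of degree `2^{k+2}` with group `Q_{2^{k+2}}` (the fixed
field of `C_q`; parts I, II and IV). [cite: Shimura1998, §8.2 Prop. 26] [cite: Kubota1965, §4 Lemma 2] -/
theorem isNondegenerate_or_exists_induced_dicyclic {k q : ℕ} (hn : n = 2 ^ k * q) (hq : q.Prime) (hq2 : q ≠ 2)
    (e : (F ≃ₐ[ℚ] F) ≃* QuaternionGroup n) (Φ : CMType F) :
    IsNondegenerate Φ ∨
      ∃ (K₀ : IntermediateField ℚ F) (_ : IsCMField K₀) (_ : IsGalois ℚ K₀) (Φ₀ : CMType K₀),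
        inducedCMType (algebraMap K₀ F) Φ₀ = Φ ∧ IsNondegenerate Φ₀ ∧ Module.finrank ℚ K₀ = 2 ^ (k + 2) ∧
        Nonempty ((K₀ ≃ₐ[ℚ] K₀) ≃* QuaternionGroup (2 ^ k)) := by
  classical
  obtain ⟨φ₀⟩ := (inferInstance : Nonempty (F →+* ℂ))
  by_cases hprim : IsPrimitive (ℂ ≃+* ℂ) Φ.1 φ₀
  · exact Or.inl (isNondegenerate_of_isPrimitive_dicyclic hn hq hq2 e φ₀ hprim)
  · right
    set S : Finset (QuaternionGroup n) := Finset.univ.filter fun y => embOf φ₀ (e.symm y) ∈ Φ.1 with hS_def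
    have hS : ∀ y, y ∈ S ↔ embOf φ₀ (e.symm y) ∈ Φ.1 := fun y => by
      simp only [hS_def, Finset.mem_filter, Finset.mem_univ, true_and]
    have hstab := (not_isPrimitive_iff_dicyclic hn hq e Φ φ₀ S hS).1 hprim
    obtain ⟨H, hHn, hmem, hcH, hG, ⟨e₀⟩, -, hdeg⟩ :=
      exists_kernel_subgroup_quaternion hn (hq.odd_of_ne_two hq2) e
    haveI : IsCMField (IntermediateField.fixedField H) := isCMField_fixedField_of_not_mem H hcH
    haveI : IsGalois ℚ (IntermediateField.fixedField H) := hG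
    obtain ⟨Φ₀, hΦ₀⟩ :=
      exists_inducedCMType_fixedField_of_leftStabiliser e Φ φ₀ S hS hstab H fun u hu => (hmem u).1 hu
    exact ⟨_, inferInstance, hG, Φ₀, hΦ₀, isNondegenerate_quaternion (k := k) rfl e₀ Φ₀, hdeg, ⟨e₀⟩⟩

/-! ## §2 Every abelian variety with an `F`-action is stably nondegenerate -/

section Geometry

/-- **THEOREM (ALL TYPES).  Let `F` be a Galois CM field with `Gal(F/ℚ) ≅ Dic_n`, `n = 2^k q` with `q` an odd prime.
Then EVERY complex abelian variety `X` of dimension `2n` whose endomorphism algebra receives `F` — simple or not,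
of any CM type — is STABLY NONDEGENERATE: `B = D` on all powers `X^{N+1}`.**  THE type of `(X, φ)` is nondegenerate
or induced from a nondegenerate type of `F^{C_q}` (§1), and both feed the tree's junction
`EndFieldFullDegree.isStablyNondegenerate_of_isNondegenerate(_cmTypeOfPair)` (`X ∼ A_Φ`, resp. `X ∼ B^q`).
UNCONDITIONAL. [cite: Shimura1998, §5.1 Prop. 3, §6.2 Thm. 3, §8.2 Prop. 26] [cite: Gordon1999HodgeAVSurvey, Thm. 6.4 and Def. 7.6] -/
theorem isStablyNondegenerate_of_ringHom_dicyclic {k q : ℕ} (hn : n = 2 ^ k * q) (hq : q.Prime) (hq2 : q ≠ 2)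
    (e : (F ≃ₐ[ℚ] F) ≃* QuaternionGroup n) {X : AbelianVariety ℂ} (hXd : X.dim = 2 * n)
    (φ : F →+* X.endAlgebra) : IsStablyNondegenerate X := by
  have hF : Module.finrank ℚ F = 2 * X.dim := by rw [finrank_eq_four_mul e, hXd]; ring
  rcases isNondegenerate_or_exists_induced_dicyclic hn hq hq2 e (cmTypeOfPair φ hF) with
    h | ⟨K₀, hK₀, -, Φ₀, hΦ, hΦ₀, -, -⟩
  · exact EndFieldFullDegree.isStablyNondegenerate_of_isNondegenerate_cmTypeOfPair φ hF h
  · haveI := hK₀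
    exact EndFieldFullDegree.isStablyNondegenerate_of_isNondegenerate φ hF hΦ hΦ₀

/-- **The Hodge conjecture for every power `X^{N+1}`** of such an `X`, UNCONDITIONALLY.
[cite: Gordon1999HodgeAVSurvey, Thm. 6.4 and Def. 7.6] -/
theorem hodgeConjectureFor_powSucc_of_ringHom_dicyclic {k q : ℕ} (hn : n = 2 ^ k * q) (hq : q.Prime) (hq2 : q ≠ 2)
    (e : (F ≃ₐ[ℚ] F) ≃* QuaternionGroup n) {X : AbelianVariety ℂ} (hXd : X.dim = 2 * n)
    (φ : F →+* X.endAlgebra) (N : ℕ) : HodgeConjectureFor (X.powSucc N).dim (X.powSucc N).X :=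
  (isStablyNondegenerate_of_ringHom_dicyclic hn hq hq2 e hXd φ).hodgeConjectureFor_powSucc N

/-- **The Hodge conjecture for every complex abelian variety isogenous to a power of an abelian variety `X` of
dimension `2n` carrying an action of a Galois CM field `F` with `Gal(F/ℚ) ≅ Dic_n`, `n = 2^k q`** — gen 20's
`hodgeConjectureFor_of_isIsogenous_powSucc_of_ringHom_dicyclic` WITHOUT the simplicity hypothesis. UNCONDITIONAL.
[cite: Gordon1999HodgeAVSurvey, Thm. 6.4 and §9.3–9.4] [cite: vanGeemen1994HodgeAV, Lemma 3.7] -/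
theorem hodgeConjectureFor_of_isIsogenous_powSucc_dicyclic {k q : ℕ} (hn : n = 2 ^ k * q) (hq : q.Prime)
    (hq2 : q ≠ 2) (e : (F ≃ₐ[ℚ] F) ≃* QuaternionGroup n) {X : AbelianVariety ℂ} (hXd : X.dim = 2 * n)
    (φ : F →+* X.endAlgebra) {B : AbelianVariety ℂ} {N : ℕ} (h : IsIsogenous B (X.powSucc N)) :
    HodgeConjectureFor B.dim B.X :=
  (isStablyNondegenerate_of_ringHom_dicyclic hn hq hq2 e hXd φ).hodgeConjectureFor_of_isIsogenous_powSucc h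

/-- `B = D` for everything isogenous to a power of such an `X`. [cite: Gordon1999HodgeAVSurvey, Thm. 6.4 and Rem. 7.6.1] -/
theorem isDivisorGenerated_of_isIsogenous_powSucc_dicyclic {k q : ℕ} (hn : n = 2 ^ k * q) (hq : q.Prime)
    (hq2 : q ≠ 2) (e : (F ≃ₐ[ℚ] F) ≃* QuaternionGroup n) {X : AbelianVariety ℂ} (hXd : X.dim = 2 * n)
    (φ : F →+* X.endAlgebra) {B : AbelianVariety ℂ} {N : ℕ} (h : IsIsogenous B (X.powSucc N)) :
    IsDivisorGenerated B :=
  (((isStablyNondegenerate_of_ringHom_dicyclic hn hq hq2 e hXd φ).powSucc N).of_isIsogenous h).isDivisorGenerated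

/-- The Hodge conjecture for `X` itself. [cite: Gordon1999HodgeAVSurvey, Thm. 6.4] -/
theorem hodgeConjectureFor_of_ringHom_dicyclic_all {k q : ℕ} (hn : n = 2 ^ k * q) (hq : q.Prime) (hq2 : q ≠ 2)
    (e : (F ≃ₐ[ℚ] F) ≃* QuaternionGroup n) {X : AbelianVariety ℂ} (hXd : X.dim = 2 * n)
    (φ : F →+* X.endAlgebra) : HodgeConjectureFor X.dim X.X :=
  (isStablyNondegenerate_of_ringHom_dicyclic hn hq hq2 e hXd φ).hodgeConjectureFor

variable {Φ : CMType F} {A : AbelianVariety ℂ} {ι : 𝓞 F →+* End A} {θ : F →+* Module.End ℂ (complexBetti A.X 1)}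

/-- **Realisation form**: every abelian variety `(A, ι)` of ANY CM type `(F; Φ)` — `F` Galois CM with
`Gal(F/ℚ) ≅ Dic_n`, `n = 2^k q` — is stably nondegenerate (`𝓞_F → End A` extends to `F → End⁰(A)`, the tree's
`exists_ringHom_endAlgebra`; `[F:ℚ] = 2 dim A`). [cite: Shimura1998, §5.1–5.2] [cite: Gordon1999HodgeAVSurvey, Thm. 6.4] -/
theorem isStablyNondegenerate_of_isCMTypeRealisation_dicyclic {k q : ℕ} (hn : n = 2 ^ k * q) (hq : q.Prime)
    (hq2 : q ≠ 2) (e : (F ≃ₐ[ℚ] F) ≃* QuaternionGroup n) (hA : IsCMTypeRealisation Φ A ι θ) :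
    IsStablyNondegenerate A := by
  obtain ⟨i, -⟩ := exists_ringHom_endAlgebra ι
  have hd : A.dim = 2 * n := by
    have h := finrank_eq_two_mul_dim_of_isCMTypeRealisation hA
    rw [finrank_eq_four_mul e] at h
    omega
  exact isStablyNondegenerate_of_ringHom_dicyclic hn hq hq2 e hd i

/-- **THE HODGE CONJECTURE FOR EVERY POWER OF EVERY ABELIAN VARIETY WITH COMPLEX MULTIPLICATION BY A GALOIS CM FIELD
WITH DICYCLIC GALOIS GROUP `Dic_n`, `n = 2^k q` (`q` an odd prime)** — gen 20's `hodgeConjectureFor_pow_of_isSimple_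
dicyclic` with the hypothesis `A.IsSimple` removed. UNCONDITIONAL. [cite: Gordon1999HodgeAVSurvey, Thm. 6.4]
[cite: Shimura1998, §5.1 Prop. 3 and §8.2 Prop. 26] -/
theorem hodgeConjectureFor_pow_dicyclic {k q : ℕ} (hn : n = 2 ^ k * q) (hq : q.Prime) (hq2 : q ≠ 2)
    (e : (F ≃ₐ[ℚ] F) ≃* QuaternionGroup n) (hA : IsCMTypeRealisation Φ A ι θ) (N : ℕ) :
    HodgeConjectureFor (⨁ fun _ : Fin N => A).dim (⨁ fun _ : Fin N => A).X :=
  hodgeConjectureFor_of_isDivisorGenerated _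
    ((isStablyNondegenerate_iff_forall_isDivisorGenerated_biproduct A).1
      (isStablyNondegenerate_of_isCMTypeRealisation_dicyclic hn hq hq2 e hA) N)

/-! ### The `n = 2^k` companion and the uniform statement -/

/-- `Gal(F/ℚ) ≅ Q_{2^{k+2}} = Dic_{2^k}`: every `X` of dimension `2n` with an `F`-action is stably nondegenerate
(every CM type of `F` is nondegenerate, part IV; in gen 20's binders as `isDivisorGenerated_of_isIsogenous_powSucc_of_
ringHom_quaternion`, here in the predicate). [cite: Gordon1999HodgeAVSurvey, Thm. 6.4 and Def. 7.6] -/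
theorem isStablyNondegenerate_of_ringHom_quaternion {k : ℕ} (hn : n = 2 ^ k) (e : (F ≃ₐ[ℚ] F) ≃* QuaternionGroup n)
    {X : AbelianVariety ℂ} (hXd : X.dim = 2 * n) (φ : F →+* X.endAlgebra) : IsStablyNondegenerate X := by
  have hF : Module.finrank ℚ F = 2 * X.dim := by rw [finrank_eq_four_mul e, hXd]; ring
  exact EndFieldFullDegree.isStablyNondegenerate_of_isNondegenerate_cmTypeOfPair φ hF
    (isNondegenerate_quaternion hn e _)

/-- **Uniform form**: `Gal(F/ℚ) ≅ Dic_n`, `n = 2^k m` with `m = 1` or `m` an odd prime ⟹ every `X` of dimension `2n`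
with an `F`-action is stably nondegenerate. [cite: Gordon1999HodgeAVSurvey, Thm. 6.4 and Def. 7.6] -/
theorem isStablyNondegenerate_of_ringHom_dicyclic' {k m : ℕ} (hn : n = 2 ^ k * m) (hm : Odd m)
    (hgood : m = 1 ∨ m.Prime) (e : (F ≃ₐ[ℚ] F) ≃* QuaternionGroup n) {X : AbelianVariety ℂ} (hXd : X.dim = 2 * n)
    (φ : F →+* X.endAlgebra) : IsStablyNondegenerate X := by
  rcases hgood with rfl | hp
  · exact isStablyNondegenerate_of_ringHom_quaternion (k := k) (by rw [hn, mul_one]) e hXd φ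
  · exact isStablyNondegenerate_of_ringHom_dicyclic hn hp (ne_two_of_odd hm) e hXd φ

end Geometry

/-! ## §3 The classification: all abelian varieties with CM by `F` are stably nondegenerate ⟺ `m ∈ {1} ∪ primes` -/

section Classification

/-- **THE CLASSIFICATION (all abelian varieties).**  `F` Galois CM with `Gal(F/ℚ) ≅ Dic_n`, `n = 2^k m`, `m` odd:
EVERY complex abelian variety of dimension `2n` with an `F`-action on `End⁰` is stably nondegenerate ⟺ `m = 1` or
`m` is prime.  (⇐ §2; ⇒: for `m` composite part V supplies a SIMPLE abelian variety realising a primitive DEGENERATE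
type, which is not stably nondegenerate by Hazama's criterion, Gordon Thm. 6.4.)  Compare part V's
`forall_isSimple_isNondegenerate_iff_dicyclic` (simple varieties only). [cite: Gordon1999HodgeAVSurvey, Thm. 6.4]
[cite: Shimura1998, §6.2 Thm. 3 and §8.2 Prop. 26] -/
theorem forall_isStablyNondegenerate_iff_dicyclic {k m : ℕ} (hn : n = 2 ^ k * m) (hm : Odd m)
    (e : (F ≃ₐ[ℚ] F) ≃* QuaternionGroup n) :
    (∀ (X : AbelianVariety ℂ) (_ : F →+* X.endAlgebra), X.dim = 2 * n → IsStablyNondegenerate X) ↔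
      (m = 1 ∨ m.Prime) := by
  refine ⟨fun h => ?_, fun hgood X φ hXd => isStablyNondegenerate_of_ringHom_dicyclic' hn hm hgood e hXd φ⟩
  by_contra hnot
  rw [not_or] at hnot
  have h2m : 2 ≤ m := by
    obtain ⟨j, hj⟩ := hm
    omega
  obtain ⟨l, hlm, h2l, hl⟩ := (Nat.not_prime_iff_exists_dvd_lt h2m).1 hnot.2
  obtain ⟨Φ, φ₀, A, ι, θ, hprim, hdeg, hA, -, hdim, -⟩ := exists_simple_degenerate_dicyclic hn hm hlm h2l hl e
  obtain ⟨i, -⟩ := exists_ringHom_endAlgebra ι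
  exact hdeg ((isStablyNondegenerate_iff_isNondegenerate φ₀ hprim hA).1 (h A i hdim))

/-- **The same in the realisation vocabulary**: every abelian variety `(A, ι)` of ANY CM type `(F; Φ)` is stably
nondegenerate ⟺ `m = 1 ∨ m` prime. [cite: Gordon1999HodgeAVSurvey, Thm. 6.4] [cite: Shimura1998, §8.2 Prop. 26] -/
theorem forall_realisation_isStablyNondegenerate_iff_dicyclic {k m : ℕ} (hn : n = 2 ^ k * m) (hm : Odd m)
    (e : (F ≃ₐ[ℚ] F) ≃* QuaternionGroup n) :
    (∀ (Φ : CMType F) (A : AbelianVariety ℂ) (ι : 𝓞 F →+* End A) (θ : F →+* Module.End ℂ (complexBetti A.X 1)),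
        IsCMTypeRealisation Φ A ι θ → IsStablyNondegenerate A) ↔ (m = 1 ∨ m.Prime) := by
  constructor
  · intro h
    by_contra hnot
    rw [not_or] at hnot
    have h2m : 2 ≤ m := by
      obtain ⟨j, hj⟩ := hm
      omega
    obtain ⟨l, hlm, h2l, hl⟩ := (Nat.not_prime_iff_exists_dvd_lt h2m).1 hnot.2
    obtain ⟨Φ, φ₀, A, ι, θ, hprim, hdeg, hA, -, -, -⟩ := exists_simple_degenerate_dicyclic hn hm hlm h2l hl e
    exact hdeg ((isStablyNondegenerate_iff_isNondegenerate φ₀ hprim hA).1 (h Φ A ι θ hA))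
  · intro hgood Φ A ι θ hA
    obtain ⟨i, -⟩ := exists_ringHom_endAlgebra ι
    have hd : A.dim = 2 * n := by
      have h := finrank_eq_two_mul_dim_of_isCMTypeRealisation hA
      rw [finrank_eq_four_mul e] at h
      omega
    exact isStablyNondegenerate_of_ringHom_dicyclic' hn hm hgood e hd i

end Classification

/-! ## §4 Class-target display -/

/-- **HC on the class «isogenous to a power of an abelian variety `X` of dimension `2n` with an action of a Galois CM
field `F` with `Gal(F/ℚ) ≅ Dic_n`, `n = 2^k m`, `m = 1` or `m` an odd prime»** — UNCONDITIONAL, NO simplicity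
hypothesis (gen 20's `hcOnClass_isIsogenous_powSucc_simple_galoisCM_dicyclic` and `…_galoisCM_quaternion` united and
strengthened). [cite: Gordon1999HodgeAVSurvey, Thm. 6.3–6.4 and §9.4] -/
theorem hcOnClass_isIsogenous_powSucc_galoisCM_dicyclic :
    HCOnClass fun B ↦ ∃ (X : AbelianVariety ℂ) (N : ℕ) (F : Type) (_ : Field F) (_ : NumberField F)
      (_ : IsCMField F) (_ : IsGalois ℚ F) (n k m : ℕ) (_ : NeZero n) (_ : (F ≃ₐ[ℚ] F) ≃* QuaternionGroup n),
      n = 2 ^ k * m ∧ Odd m ∧ (m = 1 ∨ m.Prime) ∧ X.dim = 2 * n ∧ Nonempty (F →+* X.endAlgebra) ∧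
      IsIsogenous B (X.powSucc N) := by
  rintro B ⟨X, N, F, _, _, _, _, n, k, m, _, e, hn, hm, hgood, hXd, ⟨φ⟩, h⟩
  exact (isStablyNondegenerate_of_ringHom_dicyclic' hn hm hgood e hXd φ).hodgeConjectureFor_of_isIsogenous_powSucc h

end Summit.HodgeConjecture.CorCM.GaloisDicyclic

end
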